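import Literature.Combinatorics.Sahi2008.SequentialCoupling
import Literature.Combinatorics.Sahi2008.Percolation
import HarnessLib

/-!
# Kahn (2022), footnote 1: FKG measures are FUI — every FKG weight on a finite distributive lattice is
# a monotone image of finitely many independent coins; hence Sahi's `C_n` for product measures gives
# `C_n` for all FKG measures

CITATION HEADER.  Source: J. Kahn, *A note on positive association*, arXiv:2210.08653 (2022)
[Kahn2022], read 2026-08-19 from the materialised arXiv text (`lit read arxiv:2210.08653`, pp. 1–3).
P. 1: "(1) `μ(A)μ(B) ≤ μ(A ∩ B)μ(A ∪ B) ∀ A,B ∈ Ω`.  A `μ` satisfying (1) (the 'positive lattice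
condition') is an FKG measure."  P. 2: "One way to prove PA for `μ` is to realize the `X_i`'s as
increasing functions of independent Bernoullis `Y_1,…,Y_m` and invoke Harris; … Say `μ` is FUI (for
finitely many underlying independents) in the first case … This is not as restrictive as it sounds,
since FKG measures are FUI,¹" with footnote 1: "Since it seems hard to find a reference for this, I
include here a sketch of a proof that was shown to me by Rob van den Berg, which he believes is
(implicitly) well known in the probability community: (a) Assuming the law, `μ`, of `(X_1,…,X_n)` is
FKG, let `Z_1,…,Z_n` be independent, each uniform from `[0,1]`, and for `i = 1,…,n`, if `X_j = ω_j` for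
`j < i`, let `X_i = 1` iff `Z_i > 1 − μ(X_i = 0 | X_j = ω_j ∀ j < i)`.  This is easily seen to return `μ`
as the law of `(X_1,…,X_n)`, and it's not hard to see, using (1), that the `X_i`'s are nondecreasing
in the `Z_j`'s. (b) For each `i`, the procedure in (a) depends on a finite number of events
`A(i,j) := {Z_i > α_{i,j}}`, and it's easy to realize the indicators `1_{A(i,j)}` (`j ∈ [m]`, say) as
nondecreasing functions of independent (nonidentical) Bernoullis `Y_{i,j}` (`j ∈ [m]`)."  P. 3, on
Sahi's conjecture [Sahi2008, Conj. 5]: "The conjecture is stated in [10] for FKG measures, but this is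
no more general since FKG measures are FUI."

## What is formalised (everything PROVED; no named fact; nothing asserts Sahi's or Kahn's conjecture)

Vocabulary: `IsFKGMeasure`, `SahiPositive` (`Functional.lean`), `pushWeight`, `coinWeight`
(`PushForward.lean`), the single step `stepMap`/`stepCoins` (`SequentialCoupling.lean`),
`bernoulliWeight` (`Percolation.lean`).

* **`IsFKGMeasure.exists_coinRepresentation_cube`** — footnote 1 on `{0,1}^k` (here `Fin k → Bool`
  with the product order): every FKG probability weight is `G_* (coinWeight q)` for some `m`,
  non-degenerate coins `q ∈ (0,1)^m` and a MONOTONE `G : (Fin m → Bool) → (Fin k → Bool)`; by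
  induction on `k`, one `SequentialCoupling` step per coordinate.  The representation is EXACT (no
  limit), Kahn's uniforms being replaced by finitely many threshold coins as in (b).
* **`IsFKGMeasure.exists_coinRepresentation`** — the same for an FKG probability weight on ANY finite
  distributive lattice `α` (the FKG posets of [LiebSahi2021]): Birkhoff's representation (Mathlib
  `exists_birkhoff_representation`) embeds `α` in a cube by an injective lattice homomorphism `E`,
  the zero extension `E_* μ` is FKG there (`isFKGMeasure_pushWeight`), and the monotone retraction
  `x ↦ sup {a | E a ≤ x}` brings the cube representation back to `α`.
* **`SahiPositive.of_isFKGMeasure_of_forall_coinWeight`** /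
  **`SahiPositive.of_isFKGMeasure_of_forall_bernoulliWeight`** — Kahn's p. 3 remark as a theorem, for
  every order `n`: if every product weight on a finite cube (`coinWeight q` on `Fin m → Bool`, resp.
  the tree's `bernoulliWeight p` on `Set ι`) is Sahi-positive of order `n`, then so is every FKG
  probability weight on every finite distributive lattice (`SahiPositive.of_pushWeight`: positivity
  travels along monotone maps).  Summits-side consequence (typer, cell prim-sahi):
  `SahiConjecture n ↔ ∀ ι p, SahiPositive (bernoulliWeight p) n` and `SahiConjecture 3 ↔ KahnConjecture`
  (`Summits/CriticalPhenomena/PercolationContinuityZ3/Theorems/SahiConjectureProduct.lean`).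
-/

noncomputable section

namespace Literature.Combinatorics.Sahi2008

open Finset

/-! ### Footnote 1 on the cube `{0,1}^k` -/

/-- **FKG measures on `{0,1}^k` are FUI** (Kahn, footnote 1, van den Berg): every FKG probability
weight on `Fin k → Bool` is the law of a MONOTONE function of finitely many independent non-degenerate
coins — `μ = G_* (coinWeight q)`, `q ∈ (0,1)^m`, `G` monotone.  Induction on `k`: the marginal on the
last `k` coordinates is FKG and represented by induction; coordinate `0` is then accepted with its
(monotone) conditional probability, realised exactly by threshold coins (`SequentialCoupling.lean`).
[cite: Kahn2022, p. 2 footnote 1] -/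
theorem IsFKGMeasure.exists_coinRepresentation_cube :
    ∀ (k : ℕ) (μ : (Fin k → Bool) → ℝ), IsFKGMeasure μ →
      ∃ (m : ℕ) (q : Fin m → ℝ) (G : (Fin m → Bool) → (Fin k → Bool)),
        (∀ i, 0 < q i ∧ q i < 1) ∧ Monotone G ∧ μ = pushWeight (coinWeight q) G
  | 0, μ, hμ => by
    classical
    refine ⟨0, fun i => i.elim0, fun _ => fun i => i.elim0, fun i => i.elim0, fun _ _ _ => le_rfl, ?_⟩
    funext x
    have hx : ∀ y : Fin 0 → Bool, y = x := fun y => Subsingleton.elim _ _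
    have hμx : μ x = 1 := by
      have h := hμ.sum_eq_one
      rw [Fintype.sum_subsingleton _ x] at h
      exact h
    rw [hμx, pushWeight_apply, Fintype.sum_subsingleton _ (fun i : Fin 0 => i.elim0), if_pos (hx _)]
    unfold coinWeight
    exact (Fin.prod_univ_zero _).symm
  | k + 1, μ, hμ => by
    obtain ⟨m, q₁, G₁, hq₁, hG₁, hrep⟩ :=
      IsFKGMeasure.exists_coinRepresentation_cube k (tailMarginal μ) (isFKGMeasure_tailMarginal hμ)
    exact ⟨m + numThr μ, stepCoins μ q₁, stepMap μ G₁, append_mem_Ioo hq₁ (thrCoin_mem_Ioo μ),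
      stepMap_mono hμ hq₁ hG₁ hrep, (pushWeight_stepMap hμ hrep).symm⟩

/-! ### Birkhoff: from the cube to every finite distributive lattice -/

section Lattice

variable {α : Type*} [DistribLattice α] [Fintype α]

/-- Boolean coordinates of a finset along an enumeration of the ground set (plumbing). [folklore] -/
private def toCube {β : Type*} [Fintype β] [DecidableEq β] (e : β ≃ Fin (Fintype.card β))
    (s : Finset β) : Fin (Fintype.card β) → Bool :=
  fun i => decide (e.symm i ∈ s)

/-- `toCube` is injective (plumbing). [folklore] -/
private theorem toCube_injective {β : Type*} [Fintype β] [DecidableEq β]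
    (e : β ≃ Fin (Fintype.card β)) : Function.Injective (toCube e) := by
  intro s t h
  ext b
  have hb : decide (e.symm (e b) ∈ s) = decide (e.symm (e b) ∈ t) := congrFun h (e b)
  rw [Equiv.symm_apply_apply] at hb
  constructor
  · intro hs
    have : decide (b ∈ t) = true := by rw [← hb]; exact decide_eq_true hs
    exact of_decide_eq_true this
  · intro ht
    have : decide (b ∈ s) = true := by rw [hb]; exact decide_eq_true ht
    exact of_decide_eq_true this

/-- `toCube` turns `∩` into `⊓` (plumbing). [folklore] -/
private theorem toCube_inter {β : Type*} [Fintype β] [DecidableEq β] (e : β ≃ Fin (Fintype.card β))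
    (s t : Finset β) : toCube e (s ∩ t) = toCube e s ⊓ toCube e t := by
  funext i
  show decide (e.symm i ∈ s ∩ t) = (decide (e.symm i ∈ s) && decide (e.symm i ∈ t))
  by_cases hs : e.symm i ∈ s <;> by_cases ht : e.symm i ∈ t <;> simp [hs, ht]

/-- `toCube` turns `∪` into `⊔` (plumbing). [folklore] -/
private theorem toCube_union {β : Type*} [Fintype β] [DecidableEq β] (e : β ≃ Fin (Fintype.card β))
    (s t : Finset β) : toCube e (s ∪ t) = toCube e s ⊔ toCube e t := by
  funext i
  show decide (e.symm i ∈ s ∪ t) = (decide (e.symm i ∈ s) || decide (e.symm i ∈ t))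
  by_cases hs : e.symm i ∈ s <;> by_cases ht : e.symm i ∈ t <;> simp [hs, ht]

open Classical in
/-- The monotone retraction of an embedding: `x ↦ sup {a | E a ≤ x}` (a fixed minimal element when
the set is empty) (plumbing). [folklore] -/
private def retract {γ : Type*} [Preorder γ] (E : α → γ) (a₀ : α) (x : γ) : α :=
  if h : (univ.filter fun a => E a ≤ x).Nonempty then (univ.filter fun a => E a ≤ x).sup' h id else a₀

/-- The retraction is monotone (plumbing). [folklore] -/
private theorem retract_mono {γ : Type*} [Preorder γ] (E : α → γ) {a₀ : α} (ha₀ : ∀ a, a₀ ≤ a) :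
    Monotone (retract E a₀) := by
  classical
  intro x y hxy
  unfold retract
  by_cases hx : (univ.filter fun a => E a ≤ x).Nonempty
  · have hsub : (univ.filter fun a => E a ≤ x) ⊆ univ.filter fun a => E a ≤ y := by
      intro a ha
      simp only [mem_filter, mem_univ, true_and] at ha ⊢
      exact le_trans ha hxy
    have hy : (univ.filter fun a => E a ≤ y).Nonempty := hx.mono hsub
    rw [dif_pos hx, dif_pos hy]
    exact sup'_mono id hsub hx
  · rw [dif_neg hx]
    exact ha₀ _

/-- The retraction is a left inverse of an order-reflecting map (plumbing). [folklore] -/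
private theorem retract_apply {γ : Type*} [Preorder γ] {E : α → γ} (hE : ∀ a b, E a ≤ E b → a ≤ b)
    (a₀ a : α) : retract E a₀ (E a) = a := by
  classical
  have hS : (univ.filter fun b => E b ≤ E a).Nonempty := ⟨a, mem_filter.2 ⟨mem_univ _, le_rfl⟩⟩
  unfold retract
  rw [dif_pos hS]
  refine le_antisymm (sup'_le hS id fun b hb => hE b a (mem_filter.1 hb).2) ?_
  exact le_sup' (s := univ.filter fun b => E b ≤ E a) id (mem_filter.2 ⟨mem_univ a, le_rfl⟩)

/-- **FKG measures are FUI** (Kahn, footnote 1), for the FKG posets of Lieb–Sahi: every FKG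
probability weight `μ` on a finite distributive lattice `α` is the law of a MONOTONE function of
finitely many independent non-degenerate coins: `μ = G_* (coinWeight q)` with `q ∈ (0,1)^m` and
`G : (Fin m → Bool) → α` monotone.  (Birkhoff's representation — Mathlib's
`exists_birkhoff_representation` — reduces to the cube; the zero extension along the lattice embedding
is FKG, `isFKGMeasure_pushWeight`; a monotone retraction pulls the cube representation back.)
[cite: Kahn2022, p. 2 footnote 1; LiebSahi2021, §1 (FKG posets)] -/
theorem IsFKGMeasure.exists_coinRepresentation {μ : α → ℝ} (hμ : IsFKGMeasure μ) :
    ∃ (m : ℕ) (q : Fin m → ℝ) (G : (Fin m → Bool) → α),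
      (∀ i, 0 < q i ∧ q i < 1) ∧ Monotone G ∧ μ = pushWeight (coinWeight q) G := by
  classical
  -- `α` is nonempty (total mass one), hence has a least element
  have hne : Nonempty α := by
    by_contra h
    rw [not_nonempty_iff] at h
    have h1 := hμ.sum_eq_one
    rw [univ_eq_empty, sum_empty] at h1
    exact zero_ne_one h1
  obtain ⟨x₀⟩ := hne
  obtain ⟨a₀, ha₀⟩ : ∃ a₀ : α, ∀ a, a₀ ≤ a :=
    ⟨univ.inf' ⟨x₀, mem_univ _⟩ id, fun a => inf'_le id (mem_univ a)⟩
  -- Birkhoff's representation and Boolean coordinates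
  obtain ⟨β, _, _, f, hf⟩ := exists_birkhoff_representation α
  let e := Fintype.equivFin β
  let E : α → (Fin (Fintype.card β) → Bool) := fun a => toCube e (f a)
  have hEinj : Function.Injective E := fun a b h => hf (toCube_injective e h)
  have hEinf : ∀ a b, E (a ⊓ b) = E a ⊓ E b := fun a b => by
    show toCube e (f (a ⊓ b)) = toCube e (f a) ⊓ toCube e (f b)
    rw [map_inf]
    exact toCube_inter e _ _
  have hEsup : ∀ a b, E (a ⊔ b) = E a ⊔ E b := fun a b => by
    show toCube e (f (a ⊔ b)) = toCube e (f a) ⊔ toCube e (f b)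
    rw [map_sup]
    exact toCube_union e _ _
  have hErefl : ∀ a b, E a ≤ E b → a ≤ b := fun a b h => by
    have h' : E (a ⊓ b) = E a := by rw [hEinf, inf_eq_left.2 h]
    exact inf_eq_left.1 (hEinj h')
  -- the zero extension is FKG on the cube; represent it there and retract
  have hμ' : IsFKGMeasure (pushWeight μ E) := isFKGMeasure_pushWeight hμ hEinj hEinf hEsup
  obtain ⟨m, q, G, hq, hG, hrep⟩ := IsFKGMeasure.exists_coinRepresentation_cube _ _ hμ'
  refine ⟨m, q, retract E a₀ ∘ G, hq, (retract_mono E ha₀).comp hG, ?_⟩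
  have hret : retract E a₀ ∘ E = id := funext fun a => retract_apply hErefl a₀ a
  calc μ = pushWeight μ id := (pushWeight_id μ).symm
    _ = pushWeight μ (retract E a₀ ∘ E) := by rw [hret]
    _ = pushWeight (pushWeight μ E) (retract E a₀) := (pushWeight_pushWeight μ E _).symm
    _ = pushWeight (coinWeight q) (retract E a₀ ∘ G) := by rw [hrep, pushWeight_pushWeight]

/-- **Sahi's `C_n` for product measures gives `C_n` for every FKG poset** (Kahn, p. 3: Sahi's
conjecture for FKG measures "is no more general since FKG measures are FUI"), coin form: if for
every `m` and every non-degenerate `q ∈ (0,1)^m` the product weight `coinWeight q` on `Fin m → Bool` is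
Sahi-positive of order `n`, then every FKG probability weight on every finite distributive lattice is
Sahi-positive of order `n`. [cite: Kahn2022, p. 3 (before Conj. 5) and p. 2 footnote 1] -/
theorem SahiPositive.of_isFKGMeasure_of_forall_coinWeight {n : ℕ}
    (hC : ∀ (m : ℕ) (q : Fin m → ℝ), (∀ i, 0 < q i ∧ q i < 1) → SahiPositive (coinWeight q) n)
    {μ : α → ℝ} (hμ : IsFKGMeasure μ) : SahiPositive μ n := by
  obtain ⟨m, q, G, hq, hG, hrep⟩ := hμ.exists_coinRepresentation
  rw [hrep]
  exact (hC m q hq).of_pushWeight hG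

open Classical in
/-- The cube `Fin m → Bool` as the image of the power set `Set (Fin m)` (plumbing). [folklore] -/
private def setToCube (m : ℕ) : Set (Fin m) ≃ (Fin m → Bool) where
  toFun s i := decide (i ∈ s)
  invFun y := {i | y i = true}
  left_inv s := by ext i; simp
  right_inv y := by funext i; simp

/-- `setToCube` is monotone (plumbing). [folklore] -/
private theorem setToCube_mono (m : ℕ) : Monotone (setToCube m) := by
  classical
  intro s t hst i
  show decide (i ∈ s) ≤ decide (i ∈ t)
  exact Bool.le_iff_imp.2 fun h => by
    rw [decide_eq_true_eq] at h ⊢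
    exact hst h

/-- The tree's product weight `bernoulliWeight` on `Set (Fin m)` pushes forward to `coinWeight` on the
cube (plumbing). [folklore] -/
private theorem pushWeight_bernoulliWeight_setToCube {m : ℕ} (q : Fin m → ℝ)
    (hq : ∀ i, 0 < q i ∧ q i < 1) :
    pushWeight (bernoulliWeight (fun i => ⟨q i, (hq i).1.le, (hq i).2.le⟩ : Fin m → unitInterval))
      (setToCube m) = coinWeight q := by
  classical
  funext y
  rw [pushWeight_equiv]
  show Literature.Probability.Percolation.BHK2006.weight _ {i | y i = true} = coinWeight q y
  unfold Literature.Probability.Percolation.BHK2006.weight coinWeight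
  refine prod_congr rfl fun i _ => ?_
  by_cases h : y i = true <;> simp [h]

/-- **Sahi's `C_n` for product measures gives `C_n` for every FKG poset**, in the tree's percolation
vocabulary: if for every finite `ι : Type` and every `p : ι → [0,1]` the product weight
`bernoulliWeight p` on `Set ι` is Sahi-positive of order `n`, then so is every FKG probability weight
on every finite distributive lattice.  (For `n = 3` the hypothesis is Kahn's Conjecture 5 by the layer
cake, `Summit…kahnConjecture_iff_sahiPositive`; the conclusion quantified over all FKG posets is the
obligation `Summit…SahiConjecture n`.) [cite: Kahn2022, p. 3 (before Conj. 5) and p. 2 footnote 1; LiebSahi2021, Conj. 1.1] -/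
theorem SahiPositive.of_isFKGMeasure_of_forall_bernoulliWeight {n : ℕ}
    (hC : ∀ (ι : Type) [Fintype ι] (p : ι → unitInterval), SahiPositive (bernoulliWeight p) n)
    {μ : α → ℝ} (hμ : IsFKGMeasure μ) : SahiPositive μ n := by
  refine SahiPositive.of_isFKGMeasure_of_forall_coinWeight (fun m q hq => ?_) hμ
  rw [← pushWeight_bernoulliWeight_setToCube q hq]
  exact (hC (Fin m) _).of_pushWeight (setToCube_mono m)

end Lattice

end Literature.Combinatorics.Sahi2008
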